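import Mathlib

/-!
# Route BarrierLever — item `PartitionMinorsHitByVP` (stmt-ValiantsHypothesis-19717):
# preliminaries for the BLOCK generalized-Vandermonde theorem (block-contiguous certificates)

Helper file (`--supports stmt-ValiantsHypothesis-19717`; cell valiant-natproofs, rung V4, 𝒟-side door (c),
prover seat val-np-p1, gen 11). Closes NO item; definition-free; pure algebra over a field `K` and `K[X]`.

Four reusable pieces for `…BlockVandermonde` (the nonsingularity of generalized Vandermonde matrices
`[F_j(ξ_i)]` whose exponent runs match the valuation classes of the `ξ_i`, which in turn feeds the
BLOCK-CONTIGUOUS certificate for item 19717, file `…HitByVPBlockContiguous`):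

1. `pascal_det_eq_one`: the Pascal block `[C(A + b, a)]_{a,b < g}` has determinant `1` in EVERY characteristic
   (LU factorisation: multiplication by `(1+X)^A` on `K[X]/(X^g)` is unitriangular, and `[C(b, a)]` is unitriangular).
2. `exists_runEquiv`: `g` distinct naturals pairwise closer than `g` form a run `A, A+1, …, A+g−1`
   (the bijection with `Fin g`).
3. `eval_node_eq_sum` / `map_coeff_modByMonic_nodes`: Lagrange–Taylor division of `G ∈ K[X][Y]` by the node
   polynomial `∏_i (Y − X ρ_i)`: the values `G(X ρ_i)` are read off the remainder, and the remainder's coefficients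
   reduce modulo `X` to the coefficients of `G mod X` (the nodes vanish modulo `X`).
4. `det_fromBlocks_ne_zero_of_schur`: adjugate block elimination over a commutative ring without inverting anything:
   `det A₁₁ • D − C · adj(A₁₁) · B` nonsingular and `det A₁₁ ≠ 0` ⇒ the block matrix is nonsingular (domain).

WHAT THIS IS NOT: no statement about circuits or layouts here; item 19717 stays open; nothing on CPM
(20172/20195), crux 14610 or VP vs VNP.
-/

set_option linter.dupNamespace false

namespace Summit.ValiantsHypothesis.ValiantsHypothesis.Theorems.BarrierLever.BlockVandermonde

open Finset Polynomial Matrix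

noncomputable section

variable {K : Type*} [Field K]

/-! ## 1. The Pascal block is unimodular -/

/-- `(1+X)^b = Σ_{l<g} C(b,l) X^l` as a sum over `Fin g` when `b < g`. -/
theorem one_add_X_pow_eq_sum (g : ℕ) (b : Fin g) :
    ((1 + X : K[X]) ^ (b : ℕ)) = ∑ l : Fin g, C ((((b : ℕ).choose (l : ℕ) : ℕ) : K)) * X ^ (l : ℕ) := by
  have h1 : (1 + X : K[X]).natDegree ≤ 1 := (natDegree_add_le _ _).trans (by simp)
  have hdeg : ((1 + X : K[X]) ^ (b : ℕ)).natDegree < g :=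
    lt_of_le_of_lt (natDegree_pow_le_of_le (b : ℕ) h1) (by rw [mul_one]; exact b.isLt)
  conv_lhs => rw [((1 + X : K[X]) ^ (b : ℕ)).as_sum_range_C_mul_X_pow' hdeg]
  rw [← Fin.sum_univ_eq_sum_range (fun l => C (((1 + X : K[X]) ^ (b : ℕ)).coeff l) * X ^ l) g]
  refine Finset.sum_congr rfl fun l _ => ?_
  rw [coeff_one_add_X_pow]

/-- **The Pascal block `[C(A + b, a)]_{a, b < g}` has determinant `1`** over any field (any characteristic):
it factors as (multiplication by `(1+X)^A` on `K[X]/(X^g)`, lower unitriangular) × (`[C(b, a)]`, upper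
unitriangular). -/
theorem pascal_det_eq_one (A g : ℕ) :
    (Matrix.of fun a b : Fin g => (((A + (b : ℕ)).choose (a : ℕ) : ℕ) : K)).det = 1 := by
  let L : Matrix (Fin g) (Fin g) K :=
    Matrix.of fun a l => (((1 + X : K[X]) ^ A) * X ^ (l : ℕ)).coeff a
  let U : Matrix (Fin g) (Fin g) K := Matrix.of fun l b => ((((b : ℕ).choose (l : ℕ) : ℕ) : K))
  have hLU : (Matrix.of fun a b : Fin g => (((A + (b : ℕ)).choose (a : ℕ) : ℕ) : K)) = L * U := by
    ext a b
    calc (((A + (b : ℕ)).choose (a : ℕ) : ℕ) : K)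
        = (((1 + X : K[X]) ^ A) * (1 + X) ^ (b : ℕ)).coeff a := by
          rw [← pow_add, coeff_one_add_X_pow]
      _ = ∑ l : Fin g, (((1 + X : K[X]) ^ A) * X ^ (l : ℕ)).coeff a * ((((b : ℕ).choose (l : ℕ) : ℕ) : K)) := by
          rw [one_add_X_pow_eq_sum g b, Finset.mul_sum, finsetSum_coeff]
          refine Finset.sum_congr rfl fun l _ => ?_
          rw [mul_left_comm, coeff_C_mul, mul_comm]
      _ = (L * U) a b := by
          rw [Matrix.mul_apply]
          rfl
  have hL : L.BlockTriangular OrderDual.toDual := by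
    intro a l hal
    -- `hal : toDual l < toDual a`, i.e. `a < l`
    have hal' : (a : ℕ) < l := hal
    show (((1 + X : K[X]) ^ A) * X ^ (l : ℕ)).coeff a = 0
    rw [coeff_mul_X_pow', if_neg (not_le.mpr hal')]
  have hU : U.BlockTriangular id := by
    intro l b hlb
    have hlb' : (b : ℕ) < l := hlb
    show ((((b : ℕ).choose (l : ℕ) : ℕ) : K)) = 0
    rw [Nat.choose_eq_zero_of_lt hlb', Nat.cast_zero]
  have hdetL : L.det = 1 := by
    rw [Matrix.det_of_lowerTriangular L hL]
    refine Finset.prod_eq_one fun a _ => ?_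
    show (((1 + X : K[X]) ^ A) * X ^ (a : ℕ)).coeff a = 1
    rw [coeff_mul_X_pow', if_pos le_rfl, Nat.sub_self, coeff_zero_eq_eval_zero]
    simp
  have hdetU : U.det = 1 := by
    rw [Matrix.det_of_upperTriangular hU]
    refine Finset.prod_eq_one fun b _ => ?_
    show ((((b : ℕ).choose (b : ℕ) : ℕ) : K)) = 1
    rw [Nat.choose_self, Nat.cast_one]
  rw [hLU, Matrix.det_mul, hdetL, hdetU, mul_one]

/-! ## 2. Distinct naturals pairwise closer than their number form a run -/

/-- **Runs.** If `D` is injective on a finite type of size `g` and any two values differ by `< g`, then the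
values are exactly `A, A+1, …, A+g−1` with `A` the minimum: the map `i ↦ D i − A` is a bijection onto `Fin g`. -/
theorem exists_runEquiv {ι : Type*} [Fintype ι] [DecidableEq ι] [Nonempty ι] (D : ι → ℕ)
    (hD : Function.Injective D) (hclose : ∀ i i', D i < D i' + Fintype.card ι) :
    ∃ (A : ℕ) (κ : ι ≃ Fin (Fintype.card ι)), (∃ i₀, D i₀ = A) ∧ ∀ i, D i = A + (κ i : ℕ) := by
  obtain ⟨i₀, -, hi₀⟩ := Finset.exists_min_image Finset.univ D Finset.univ_nonempty
  have hA : ∀ i, D i₀ ≤ D i := fun i => hi₀ i (Finset.mem_univ i)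
  have hlt : ∀ i, D i - D i₀ < Fintype.card ι := fun i => by
    have := hclose i i₀
    have := hA i
    omega
  let f : ι → Fin (Fintype.card ι) := fun i => ⟨D i - D i₀, hlt i⟩
  have hf : Function.Injective f := by
    intro i i' hii'
    have h' : D i - D i₀ = D i' - D i₀ := congrArg Fin.val hii'
    have := hA i
    have := hA i'
    exact hD (by omega)
  have hbij : Function.Bijective f :=
    (Fintype.bijective_iff_injective_and_card f).mpr ⟨hf, by simp⟩
  refine ⟨D i₀, Equiv.ofBijective f hbij, ⟨i₀, rfl⟩, fun i => ?_⟩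
  show D i = D i₀ + (D i - D i₀)
  have := hA i
  omega

/-! ## 3. Division by a node polynomial -/

/-- The node polynomial `∏_i (Y − x_i)` is monic. -/
theorem monic_nodePoly {R : Type*} [CommRing R] {ι : Type*} [Fintype ι] (x : ι → R) :
    (∏ i : ι, (X - C (x i))).Monic :=
  monic_prod_of_monic _ _ fun i _ => monic_X_sub_C (x i)

/-- The node polynomial has degree the number of nodes. -/
theorem natDegree_nodePoly {R : Type*} [CommRing R] [Nontrivial R] {ι : Type*} [Fintype ι] (x : ι → R) :
    (∏ i : ι, (X - C (x i))).natDegree = Fintype.card ι := by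
  rw [natDegree_prod_of_monic _ _ fun i _ => monic_X_sub_C (x i)]
  simp

/-- **Values at the nodes are read off the remainder.** For `G ∈ R[Y]` and nodes `x_i`,
`G(x_i) = Σ_{k < g} r_k x_i^k` where `r = G mod ∏ (Y − x_i)` and `g` is the number of nodes. -/
theorem eval_node_eq_sum {R : Type*} [CommRing R] [Nontrivial R] {ι : Type*} [Fintype ι] (x : ι → R)
    (G : R[X]) (i : ι) :
    G.eval (x i) =
      ∑ k ∈ Finset.range (Fintype.card ι), (G %ₘ ∏ i' : ι, (X - C (x i'))).coeff k * x i ^ k := by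
  have hmonic := monic_nodePoly x
  have hroot : (∏ i' : ι, (X - C (x i'))).eval (x i) = 0 := by
    rw [eval_prod]
    exact Finset.prod_eq_zero (Finset.mem_univ i) (by simp)
  have h1 : G.eval (x i) = (G %ₘ ∏ i' : ι, (X - C (x i'))).eval (x i) := by
    conv_lhs => rw [← modByMonic_add_div G (∏ i' : ι, (X - C (x i')))]
    rw [eval_add, eval_mul, hroot, zero_mul, add_zero]
  haveI : Nonempty ι := ⟨i⟩
  have hne : (∏ i' : ι, (X - C (x i'))) ≠ 1 := by
    intro h1'
    have := congrArg natDegree h1'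
    rw [natDegree_nodePoly, natDegree_one] at this
    exact Fintype.card_ne_zero this
  have hdeg : (G %ₘ ∏ i' : ι, (X - C (x i'))).natDegree < Fintype.card ι := by
    have := natDegree_modByMonic_lt G hmonic hne
    rwa [natDegree_nodePoly] at this
  rw [h1, eval_eq_sum_range' hdeg]

/-- Coefficients below `g` are unchanged by reduction modulo `Y^g`. -/
theorem coeff_modByMonic_X_pow_lt {S : Type*} [CommRing S] (p : S[X]) {g k : ℕ} (hk : k < g) :
    (p %ₘ X ^ g).coeff k = p.coeff k := by
  have h := modByMonic_add_div p (X ^ g)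
  have h' : (p %ₘ X ^ g + X ^ g * (p /ₘ X ^ g)).coeff k = p.coeff k := by rw [h]
  rwa [coeff_add, coeff_X_pow_mul', if_neg (not_le.mpr hk), add_zero] at h'

/-- **The remainder reduces, modulo the nodes, to the truncation of `G`.** If a ring map `φ` kills every node,
then `φ` of the `k`-th remainder coefficient (`k < g`) is the `k`-th coefficient of `G.map φ`. -/
theorem map_coeff_modByMonic_nodes {R S : Type*} [CommRing R] [CommRing S] (φ : R →+* S) {ι : Type*}
    [Fintype ι] (x : ι → R) (hx : ∀ i, φ (x i) = 0) (G : R[X]) {k : ℕ} (hk : k < Fintype.card ι) :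
    φ ((G %ₘ ∏ i : ι, (X - C (x i))).coeff k) = (G.map φ).coeff k := by
  rw [← coeff_map, map_modByMonic φ (monic_nodePoly x)]
  have hP : (∏ i : ι, (X - C (x i))).map φ = X ^ Fintype.card ι := by
    rw [Polynomial.map_prod φ]
    simp only [Polynomial.map_sub, map_X, map_C, hx, map_zero, sub_zero]
    rw [Finset.prod_const, Finset.card_univ]
  rw [hP, coeff_modByMonic_X_pow_lt _ hk]

/-! ## 4. Adjugate block elimination -/

/-- **Schur complement without division.** Over a domain: if `det A ≠ 0` and the polynomial Schur complement
`det A • D − C · adj A · B` is nonsingular, then so is the block matrix `[[A, B], [C, D]]`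
(multiply on the left by `[[1, 0], [−C·adj A, det A • 1]]`). -/
theorem det_fromBlocks_ne_zero_of_schur {R : Type*} [CommRing R] [IsDomain R] {m n : Type*} [Fintype m]
    [Fintype n] [DecidableEq m] [DecidableEq n] (A : Matrix m m R) (B : Matrix m n R) (C : Matrix n m R)
    (D : Matrix n n R) (hA : A.det ≠ 0) (hS : (A.det • D - C * A.adjugate * B).det ≠ 0) :
    (Matrix.fromBlocks A B C D).det ≠ 0 := by
  set E : Matrix (m ⊕ n) (m ⊕ n) R :=
    Matrix.fromBlocks 1 0 (-(C * A.adjugate)) (A.det • (1 : Matrix n n R)) with hE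
  have hmul : E * Matrix.fromBlocks A B C D = Matrix.fromBlocks A B 0 (A.det • D - C * A.adjugate * B) := by
    rw [hE, Matrix.fromBlocks_multiply]
    simp only [Matrix.one_mul, Matrix.zero_mul, add_zero, Matrix.neg_mul, Matrix.smul_mul,
      Matrix.mul_assoc, Matrix.adjugate_mul, Matrix.mul_smul, Matrix.mul_one, neg_add_cancel]
    congr 1
    rw [sub_eq_add_neg, add_comm]
  have hdet : E.det * (Matrix.fromBlocks A B C D).det = A.det * (A.det • D - C * A.adjugate * B).det := by
    rw [← Matrix.det_mul, hmul, Matrix.det_fromBlocks_zero₂₁]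
  intro h0
  rw [h0, mul_zero] at hdet
  exact mul_ne_zero hA hS hdet.symm

end

end Summit.ValiantsHypothesis.ValiantsHypothesis.Theorems.BarrierLever.BlockVandermonde
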